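import Summits.CriticalPhenomena.PercolationContinuityZ3.Theorems.PercNearOneGluingNoHeavyQuantGluedWindowLightOnly
import HarnessLib

/-!
# QUANT lane R8, T-DEC: LEMMA W's pair condition — the light-only two-row cell at the SURE TOP BLOB (`g = 1`): only the bottom copy must avoid
# the top copy (arm-1 gen 60, architect)

builds on p205010 (kernel theorem, internal audit signed; external expert review pending)

Support file (`--supports stmt-CriticalPhenomena-4575`), QUANT lane seat prim-quant-arm-1 (gen 60, architect); memo
`run/shared/lean/prim/quant/prim-quant-arm-1-g60/ARCH-G60.md` §5.  Theorems only; standard axioms, no sorries, no definitions.  Companion of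
`…QuantGluedWindowLightOnly`: there the middle copy `l+r` must be incompatible with the top copy `l+r+k` (`2l+2r+k ≤ T`, used only through
`A ≤ t₁r + t₂(N−r)`); when the top blob is sure (`g = 1`, `t₁ = 0`: the glued law is the two-point law `{0: 1−q, r+k: q}`) the middle copy carries no mass
and the weaker `2l + r + k ≤ T` (the BOTTOM copy incompatible with the top copy; `K ≤ N`) suffices: `A = a·qK ≤ t₂N`, and (★7) is used at `ε = 0`.
**`gluedPullback_windowPair_twoRow_lightOnlyTop`** — the single-row light patterns `-ld`, `-lld` of the census (kit j301043: ≈ 4 % of the h-mid pairs).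

HONEST STATUS.  `GluedLemmaW` (flow form), `GluedDominatedMass`, the band, `SiblingStep`, `FarTreeRow` OPEN; RATE class (log\*) / honest sentence of
`run/shared/lean/prim/quant/README.md` unchanged.  [this work].  Nothing here is cited as a published result.  The gluing rows served
[cite: KozmaNitzan2024, Conjecture 3 (p. 15)]; product measure [cite: Grimmett1999, §1.3 p. 10].
-/

set_option maxHeartbeats 4000000

noncomputable section

open scoped BigOperators

namespace Summit.CriticalPhenomena.PercolationContinuityZ3.Theorems
namespace Quant

open Finset

namespace LawDec

/-- **THE LIGHT-ONLY CELL AT THE SURE TOP BLOB**: `g = 1`, `2l + r + k ≤ T` (the bottom copy cannot use the top copy) and `T − 2l ≤ y(h − l)` (the pair is light at the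
glued target) ⟹ `(1−γ)Ψ(l) + γΨ(h) ≤ 0` for every price system and every cheap `c ≥ h` — no `GluedLemmaW`. [this work] -/
theorem gluedPullback_windowPair_twoRow_lightOnlyTop (x a q g S : ℝ) (B r k j l h c ls : ℕ) (α p : ℕ → ℝ)
    (hx0 : 0 < x) (hx1 : x < 1) (ha0 : 0 < a) (ha1 : a ≤ 1) (hq0 : 0 < q) (hq1 : q < 1) (hg0 : 0 ≤ g) (hg1 : g ≤ 1) (hr : 1 ≤ r) (hk : 1 ≤ k)
    (hxqg : x ≤ q * g)
    (hlh : l < h) (hhB : h ≤ B) (hhj : h ≤ j) (hwin : j < h + r + k) (hlow : 2 * (l : ℝ) < a * S) (hcomp : a * S < (l : ℝ) + h)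
    (hlight : pairGate (a * x) (a * S) l h < a * x)
    (hL2j : l + r + k ≤ j) (hL2mid : a * (S + q * ((r : ℝ) + k * g)) ≤ 2 * ((l : ℝ) + r + k))
    (hL1low : 2 * ((l : ℝ) + r) < a * (S + q * ((r : ℝ) + k * g))) (hhmid : a * (S + q * ((r : ℝ) + k * g)) ≤ 2 * (h : ℝ))
    (hgone : g = 1) (hincl : 2 * (l : ℝ) + r + k ≤ a * (S + q * ((r : ℝ) + k * g)))
    (hlightT : a * (S + q * ((r : ℝ) + k * g)) - 2 * (l : ℝ) ≤ (a * x) * ((h : ℝ) - l))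
    (hhc : h ≤ c) (hcB : c ≤ B) (hcj : c ≤ j)
    (hp : ∀ h, 0 ≤ p h)
    (hαp : ∀ l' h', l' ≤ j → 2 * (l' : ℝ) < a * (S + q * ((r : ℝ) + k * g)) → h' ≤ B + (r + k) →
      (j + 1 ≤ h' ∨ a * (S + q * ((r : ℝ) + k * g)) < (l' : ℝ) + h') →
      α l' ≤ usage (a * x) (a * (S + q * ((r : ℝ) + k * g))) j l' h' * p h')
    (hcheap : -(gluedPullback (a * (S + q * ((r : ℝ) + k * g))) q g j r k α p c) * (a * x)
      < (1 - a * x) * gluedPullback (a * (S + q * ((r : ℝ) + k * g))) q g j r k α p ls) :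
    (1 - pairGate (a * x) (a * S) l h) * gluedPullback (a * (S + q * ((r : ℝ) + k * g))) q g j r k α p l
      + pairGate (a * x) (a * S) l h * gluedPullback (a * (S + q * ((r : ℝ) + k * g))) q g j r k α p h ≤ 0 := by
  -- names (no `set`: the reduction theorem is applied to the original expressions at the end)
  obtain ⟨y, hy⟩ : ∃ y : ℝ, y = a * x := ⟨_, rfl⟩
  obtain ⟨T, hT⟩ : ∃ T : ℝ, T = a * (S + q * ((r : ℝ) + k * g)) := ⟨_, rfl⟩
  obtain ⟨T₀, hT₀⟩ : ∃ T₀ : ℝ, T₀ = a * S := ⟨_, rfl⟩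
  have hy0 : 0 < y := by rw [hy]; exact mul_pos ha0 hx0
  have hyx : y ≤ x := by rw [hy]; nlinarith
  have hy1 : y < 1 := by linarith
  have h1y : 0 < 1 - y := by linarith
  obtain ⟨t1, ht1⟩ : ∃ t1 : ℝ, t1 = q * (1 - g) := ⟨_, rfl⟩
  obtain ⟨t2, ht2⟩ : ∃ t2 : ℝ, t2 = q * g := ⟨_, rfl⟩
  have ht1p : 0 ≤ t1 := by rw [ht1]; exact mul_nonneg hq0.le (by linarith)
  have ht2p : 0 ≤ t2 := by rw [ht2]; exact mul_nonneg hq0.le hg0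
  have ht0p : 0 ≤ 1 - t1 - t2 := by
    rw [ht1, ht2, show 1 - q * (1 - g) - q * g = 1 - q by ring]; linarith
  have hyt2 : y ≤ t2 := by rw [ht2]; linarith
  have hr1 : (1:ℝ) ≤ r := by exact_mod_cast hr
  have hk1 : (1:ℝ) ≤ k := by exact_mod_cast hk
  have hlh' : (l : ℝ) < h := by exact_mod_cast hlh
  -- geometry: d = h − l, N = T − 2l, A = T − T₀ ≤ m = t1 r + t2 (r+k)
  obtain ⟨d, hd⟩ : ∃ d : ℝ, d = (h : ℝ) - l := ⟨_, rfl⟩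
  have hd0 : 0 < d := by rw [hd]; linarith
  obtain ⟨N, hN⟩ : ∃ N : ℝ, N = T - 2 * (l : ℝ) := ⟨_, rfl⟩
  have hA : T - T₀ = a * (q * ((r : ℝ) + k * g)) := by rw [hT, hT₀]; ring
  have hAm : T - T₀ ≤ t1 * r + t2 * ((r : ℝ) + k) := by
    rw [hA, ht1, ht2]
    have h1 : a * (q * ((r : ℝ) + k * g)) ≤ 1 * (q * ((r : ℝ) + k * g)) :=
      mul_le_mul_of_nonneg_right ha1 (by positivity)
    have e : q * (1 - g) * (r : ℝ) + q * g * ((r : ℝ) + k) = 1 * (q * ((r : ℝ) + k * g)) := by ring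
    linarith [h1, e]
  have hA0 : 0 ≤ T - T₀ := by rw [hA]; positivity
  have hNK : (r : ℝ) + k ≤ N := by rw [hN, hT]; linarith        -- 2l + r + k ≤ T
  have ht1z : t1 = 0 := by rw [ht1, hgone]; ring
  have ht2q : t2 = q := by rw [ht2, hgone]; ring
  have hNy : N ≤ y * d := by rw [hN, hd, hT, hy]; exact hlightT      -- light at T
  have hNd : N < d := lt_of_le_of_lt hNy ((mul_lt_iff_lt_one_left hd0).mpr hy1)
  -- the light gate of the first factor
  obtain ⟨ρ₀, hρ₀⟩ : ∃ ρ₀ : ℝ, ρ₀ = (T₀ - 2 * (l : ℝ)) / ((h : ℝ) - l) := ⟨_, rfl⟩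
  have hρ₀y : ρ₀ < y := by
    have : (T₀ - 2 * (l : ℝ)) / ((h : ℝ) - l) ≤ pairGate y T₀ l h := le_max_left _ _
    rw [hρ₀]; rw [hy, hT₀] at this ⊢; linarith
  obtain ⟨γ, hγ⟩ : ∃ γ : ℝ, γ = y ^ 2 + (1 - y) * ρ₀ := ⟨_, rfl⟩
  have hγ' : pairGate (a * x) (a * S) l h = γ := by
    rw [hγ, hρ₀, hT₀, hy]; exact pairGate_eq_light (a * x) (a * S) l h (mul_pos ha0 hx0).le (by rw [← hy, ← hT₀, ← hρ₀]; exact hρ₀y.le)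
  have eρ₀ : ρ₀ = (N - (T - T₀)) / d := by rw [hρ₀, hN, hd]; congr 1; ring
  have hρ₀0 : 0 < ρ₀ := by rw [hρ₀]; exact div_pos (by rw [hT₀]; linarith) (by linarith)
  -- credit ratios of the two rows into h at T
  obtain ⟨ρa, hρa⟩ : ∃ ρa : ℝ, ρa = N / d := ⟨_, rfl⟩
  obtain ⟨ρb, hρb⟩ : ∃ ρb : ℝ, ρb = (N - 2 * (r : ℝ)) / (d - r) := ⟨_, rfl⟩
  have hdr : 0 < d - r := by linarith
  have hρay : ρa ≤ y := by rw [hρa, div_le_iff₀ hd0]; linarith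
  have hρa0 : 0 < ρa := by rw [hρa]; exact div_pos (by linarith) hd0
  have hρb0 : 0 < ρb := by rw [hρb]; exact div_pos (by rw [hN, hT]; linarith) hdr
  have hN2d : N ≤ 2 * d := by rw [hN, hd, hT]; linarith
  have hr0 : (0:ℝ) ≤ r := by linarith
  have hρba : ρb ≤ ρa := by
    rw [hρa, hρb, div_le_div_iff₀ hdr hd0]; linarith [mul_le_mul_of_nonneg_left hN2d hr0]
  have hρby : ρb ≤ y := le_trans hρba hρay
  -- exact light powers
  obtain ⟨Ga, hGa⟩ : ∃ Ga : ℝ, Ga = y ^ 2 + (1 - y) * ρa := ⟨_, rfl⟩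
  obtain ⟨Gb, hGb⟩ : ∃ Gb : ℝ, Gb = y ^ 2 + (1 - y) * ρb := ⟨_, rfl⟩
  have hGa0 : 0 < Ga := by rw [hGa]; exact add_pos_of_pos_of_nonneg (pow_pos hy0 2) (mul_nonneg h1y.le hρa0.le)
  have hGb0 : 0 < Gb := by rw [hGb]; exact add_pos_of_pos_of_nonneg (pow_pos hy0 2) (mul_nonneg h1y.le hρb0.le)
  have hGa1 : 0 < 1 - Ga := by
    rw [hGa, show 1 - (y ^ 2 + (1 - y) * ρa) = (1 - y) * (1 + y - ρa) by ring]; exact mul_pos h1y (by linarith)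
  have hGb1 : 0 < 1 - Gb := by
    rw [hGb, show 1 - (y ^ 2 + (1 - y) * ρb) = (1 - y) * (1 + y - ρb) by ring]; exact mul_pos h1y (by linarith)
  obtain ⟨ϖa, hϖa⟩ : ∃ ϖa : ℝ, ϖa = (1 - Ga) / Ga := ⟨_, rfl⟩
  obtain ⟨ϖb, hϖb⟩ : ∃ ϖb : ℝ, ϖb = (1 - Gb) / Gb := ⟨_, rfl⟩
  have hϖa0 : 0 < ϖa := by rw [hϖa]; exact div_pos hGa1 hGa0
  have hϖb0 : 0 < ϖb := by rw [hϖb]; exact div_pos hGb1 hGb0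
  -- validity into h (exact light rate), into h + r (nearer-to-farther), and compatibility
  have hcompa : T < (l : ℝ) + h := by rw [hN, hd] at hNd; linarith
  have hcompb : T < ((l : ℝ) + r) + h := by
    have : N - (r : ℝ) < d := by linarith
    rw [hN, hd] at this; linarith
  have eLr : ((l + r : ℕ) : ℝ) = (l : ℝ) + r := by push_cast; ring
  have vaH : ϖa * usage y T j l h ≤ 1 := by
    have hρ : (T - 2 * (l : ℝ)) / ((h : ℝ) - l) ≤ y := by rw [← hN, ← hd, ← hρa]; exact hρay
    rw [usage_light_eq y T j l h hy0.le hhj hρ, ← hN, ← hd, ← hρa, ← hGa, hϖa, div_mul_div_comm, mul_comm (1 - Ga) Ga,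
      div_self (mul_ne_zero hGa0.ne' hGa1.ne')]
  have vbH : ϖb * usage y T j (l + r) h ≤ 1 := by
    have e1 : (T - 2 * ((l + r : ℕ) : ℝ)) / ((h : ℝ) - ((l + r : ℕ) : ℝ)) = ρb := by rw [hρb, hN, hd, eLr]; ring_nf
    have hρ : (T - 2 * ((l + r : ℕ) : ℝ)) / ((h : ℝ) - ((l + r : ℕ) : ℝ)) ≤ y := by rw [e1]; exact hρby
    rw [usage_light_eq y T j (l + r) h hy0.le hhj hρ, e1, ← hGb, hϖb, div_mul_div_comm, mul_comm (1 - Gb) Gb,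
      div_self (mul_ne_zero hGb0.ne' hGb1.ne')]
  have hlowl : 2 * (l : ℝ) < T := by linarith
  have hlowlr : 2 * ((l + r : ℕ) : ℝ) < T := by rw [eLr]; linarith
  have vaG : ϖa * usage y T j l (h + r) ≤ 1 ∨ j < h + r := by
    by_cases hjr : h + r ≤ j
    · exact Or.inl (le_trans (mul_le_mul_of_nonneg_left (usage_anti_mid y T j l h (h + r) hy0 hy1 (by omega) hjr hlowl hcompa) hϖa0.le) vaH)
    · exact Or.inr (by omega)
  have vbG : ϖb * usage y T j (l + r) (h + r) ≤ 1 ∨ j < h + r := by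
    by_cases hjr : h + r ≤ j
    · refine Or.inl (le_trans (mul_le_mul_of_nonneg_left (usage_anti_mid y T j (l + r) h (h + r) hy0 hy1 (by omega) hjr hlowlr ?_) hϖb0.le) vbH)
      rw [eLr]; exact hcompb
    · exact Or.inr (by omega)
  -- the main inequality (1−γ)(t0/ϖa + t1/ϖb) ≤ γ via (★7)
  obtain ⟨cc, hcc⟩ : ∃ cc : ℝ, cc = 1 + y - ρa := ⟨_, rfl⟩
  obtain ⟨ee, hee⟩ : ∃ ee : ℝ, ee = 0 := ⟨_, rfl⟩
  obtain ⟨aa, haa⟩ : ∃ aa : ℝ, aa = (T - T₀) / d := ⟨_, rfl⟩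
  have hcc1 : 1 ≤ cc := by rw [hcc]; linarith
  have hccy : cc ≤ 1 + y := by rw [hcc]; linarith
  have hee0 : 0 ≤ ee := by rw [hee]
  have haa0 : 0 ≤ aa := by rw [haa]; positivity
  have hee1 : 2 * ee ≤ 1 + y - cc := by rw [hee, mul_zero]; linarith
  have haamax : aa ≤ t1 * ee + t2 * (1 + y - cc - ee) := by
    rw [haa, hee, hcc, hρa, ht1z, zero_mul, zero_add, sub_zero, show 1 + y - (1 + y - N / d) = N / d by ring, ← mul_div_assoc,
      div_le_div_iff₀ hd0 hd0]
    refine mul_le_mul_of_nonneg_right ?_ hd0.le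
    -- A = a·q·K ≤ q·N = t2·N
    rw [hA, hgone, mul_one, ht2q]
    have h1 : a * (q * ((r : ℝ) + k)) ≤ 1 * (q * ((r : ℝ) + k)) := mul_le_mul_of_nonneg_right ha1 (by positivity)
    nlinarith [mul_le_mul_of_nonneg_left hNK hq0.le, h1]
  have star7 := lightOnly_star7 y cc ee t1 t2 hy0 hyt2 ht1p ht0p hcc1 hccy hee0 hee1 hy1
  have hden : 0 < cc + t2 * (1 + y - cc) + (t1 - t2) * ee := by
    have a1 : 0 ≤ t1 * ee := mul_nonneg ht1p hee0
    have a2 : t2 * ee ≤ t2 * ((1 + y - cc) / 2) := mul_le_mul_of_nonneg_left (by linarith) ht2p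
    have a3 : 0 ≤ t2 * (1 + y - cc) := mul_nonneg ht2p (by linarith)
    linarith [a1, a2, a3]
  have star6 : (1 - t1 - t2) / cc + t1 * (1 - ee) / (cc + (1 - y) * ee) + t2 * (1 - y) ≤ 1 / (cc + aa) := by
    refine le_trans star7 ?_
    rw [one_div_le_one_div hden (by linarith)]
    linarith
  -- (★5) at t1 = 0: Za = cc, Z = cc + aa, the Zb term vanishes
  obtain ⟨Zb, hZb⟩ : ∃ Zb : ℝ, Zb = 1 + y - ρb := ⟨_, rfl⟩
  have hZb0 : 0 < Zb := by rw [hZb]; linarith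
  have eZ : 1 + y - ρ₀ = cc + aa := by rw [hcc, haa, eρ₀, hρa, sub_div]; ring
  have star5 : (1 - t1 - t2) / cc + t1 / Zb + t2 * (1 - y) ≤ 1 / (1 + y - ρ₀) := by
    have z1 : t1 / Zb = 0 := by rw [ht1z, zero_div]
    have z2 : t1 * (1 - ee) / (cc + (1 - y) * ee) = 0 := by rw [ht1z, zero_mul, zero_div]
    rw [eZ, z1]; rw [z2] at star6; linarith [star6]
  have main' := lightOnly_main_of_star5 y (1 + y - ρ₀) cc Zb (1 - t1 - t2) t1 t2 hy1 (by linarith) (by linarith) hZb0 (by ring) star5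
  have eϖa : (1 - y) * cc / (1 - (1 - y) * cc) = ϖa := by
    rw [hϖa, hGa, hcc]; congr 1 <;> ring
  have eϖb : (1 - y) * Zb / (1 - (1 - y) * Zb) = ϖb := by
    rw [hϖb, hGb, hZb]; congr 1 <;> ring
  have e1γ : (1 - y) * (1 + y - ρ₀) = 1 - γ := by rw [hγ]; ring
  rw [eϖa, eϖb, e1γ, show 1 - (1 - γ) = γ by ring] at main'
  -- main' : (1 − γ) * ((1 − t1 − t2)/ϖa + t1/ϖb) ≤ γ
  have hγ0 : 0 < γ := by rw [hγ]; exact add_pos_of_pos_of_nonneg (pow_pos hy0 2) (mul_pos h1y hρ₀0).le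
  have h1γ : 0 < 1 - γ := by
    rw [hγ, show 1 - (y ^ 2 + (1 - y) * ρ₀) = (1 - y) * (1 + y - ρ₀) by ring]; exact mul_pos h1y (by linarith)
  -- the share σ = w₀/D₀ and the two coverages
  obtain ⟨σ, hσ⟩ : ∃ σ : ℝ, σ = (1 - γ) * (1 - t1 - t2) / (γ * ϖa) := ⟨_, rfl⟩
  have hγϖa : 0 < γ * ϖa := mul_pos hγ0 hϖa0
  have hσγ : σ * (γ * ϖa) = (1 - γ) * (1 - t1 - t2) := by rw [hσ]; exact div_mul_cancel₀ _ hγϖa.ne'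
  have hσ0 : 0 ≤ σ := by rw [hσ]; exact div_nonneg (mul_nonneg h1γ.le ht0p) hγϖa.le
  have m2 : (1 - γ) * (1 - t1 - t2) * ϖb + (1 - γ) * t1 * ϖa ≤ γ * ϖa * ϖb := by
    have := mul_le_mul_of_nonneg_right main' (mul_nonneg hϖa0.le hϖb0.le)
    have ca : (1 - t1 - t2) / ϖa * ϖa = 1 - t1 - t2 := div_mul_cancel₀ _ hϖa0.ne'
    have cb : t1 / ϖb * ϖb = t1 := div_mul_cancel₀ _ hϖb0.ne'
    have e : (1 - γ) * ((1 - t1 - t2) / ϖa + t1 / ϖb) * (ϖa * ϖb) = (1 - γ) * (1 - t1 - t2) * ϖb + (1 - γ) * t1 * ϖa := by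
      linear_combination ((1 - γ) * ϖb) * ca + ((1 - γ) * ϖa) * cb
    rw [e] at this; linarith
  have hσ1 : σ ≤ 1 := by
    rw [hσ, div_le_one hγϖa]
    have h3 : (1 - γ) * (1 - t1 - t2) * ϖb ≤ γ * ϖa * ϖb := by
      linarith [m2, mul_nonneg (mul_nonneg h1γ.le ht1p) hϖa0.le]
    exact le_of_mul_le_mul_right h3 hϖb0
  have cov1' : (1 - γ) * t1 ≤ (1 - σ) * (γ * ϖb) := by
    -- (1 − σ)γϖb·ϖa = γϖaϖb − (1−γ)t0ϖb ≥ (1−γ)t1ϖa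
    have e : (1 - σ) * (γ * ϖb) * ϖa = γ * ϖa * ϖb - σ * (γ * ϖa) * ϖb := by ring
    have h2 : (1 - γ) * t1 * ϖa ≤ (1 - σ) * (γ * ϖb) * ϖa := by rw [e, hσγ]; linarith
    exact le_of_mul_le_mul_right h2 hϖa0
  have et0 : 1 - t1 - t2 = 1 - q := by rw [ht1, ht2]; ring
  -- apply the reduction theorem
  by_cases hjr : h + r ≤ j
  · have vaG' : ϖa * usage y T j l (h + r) ≤ 1 := by rcases vaG with h1 | h1; exacts [h1, absurd hjr (by omega)]
    have vbG' : ϖb * usage y T j (l + r) (h + r) ≤ 1 := by rcases vbG with h1 | h1; exacts [h1, absurd hjr (by omega)]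
    refine gluedPullback_windowPair_twoRow_mid_of_share x a q g S B r k j l h c ls α p 0 σ 0 ϖa ϖa ϖa 0 ϖb ϖb ϖb
      hx0 hx1 ha0 ha1 hq0 hq1 hg0 hg1 hr hlh hhB hwin hlow hcomp hL2j hL2mid hL1low hhmid (Or.inl ⟨hjr, rfl⟩) hhc hcB hcj hp hαp hcheap
      hσ0 hσ1 le_rfl hϖa0.le hϖa0.le hϖa0.le le_rfl hϖb0.le hϖb0.le hϖb0.le ?_ (Or.inl rfl) ?_ (Or.inr ?_) ?_ (Or.inr (Or.inr ?_)) (Or.inr ⟨?_, ?_⟩)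
      ?_ (Or.inl rfl) ?_ (Or.inr ?_) ?_ (Or.inr (Or.inr ?_)) (Or.inr ⟨?_, ?_⟩) ?_ ?_
    · rw [zero_mul]; exact zero_le_one
    · rw [← hy, ← hT]; exact vaH
    · rw [← hT]; exact hcompa
    · rw [← hy, ← hT]; exact vaG'
    · rw [← hT]; linarith
    · rw [← hT]; exact hcompa
    · rw [← hy, ← hT]; exact vaH
    · rw [zero_mul]; exact zero_le_one
    · rw [← hy, ← hT]; exact vbH
    · rw [← hT]; exact hcompb
    · rw [← hy, ← hT]; exact vbG'
    · rw [← hT]; linarith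
    · rw [← hT]; exact hcompb
    · rw [← hy, ← hT]; exact vbH
    · rw [hγ', ← ht1, ← ht2, ← et0]
      have e : σ * ((1 - γ) * t2 * 0 + γ * (1 - t1 - t2) * ϖa + γ * t1 * (1 - 0) * ϖa + γ * (t2 + 0 * t1) * ϖa) = σ * (γ * ϖa) := by ring
      rw [e, hσγ]
    · rw [hγ', ← ht1, ← ht2]
      have e : (1 - σ) * ((1 - γ) * t2 * 0 + γ * (1 - q) * ϖb + γ * t1 * (1 - 0) * ϖb + γ * (t2 + 0 * t1) * ϖb)
          = (1 - σ) * (γ * ϖb) * ((1 - q) + t1 + t2) := by ring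
      rw [e, ← et0, show 1 - t1 - t2 + t1 + t2 = (1:ℝ) by ring, mul_one]
      exact cov1'
  · have hjr' : j < h + r := by omega
    refine gluedPullback_windowPair_twoRow_mid_of_share x a q g S B r k j l h c ls α p 1 σ 0 ϖa 0 ϖa 0 ϖb 0 ϖb
      hx0 hx1 ha0 ha1 hq0 hq1 hg0 hg1 hr hlh hhB hwin hlow hcomp hL2j hL2mid hL1low hhmid (Or.inr ⟨hjr', rfl⟩) hhc hcB hcj hp hαp hcheap
      hσ0 hσ1 le_rfl hϖa0.le le_rfl hϖa0.le le_rfl hϖb0.le le_rfl hϖb0.le ?_ (Or.inl rfl) ?_ (Or.inr ?_) ?_ (Or.inl rfl) (Or.inr ⟨?_, ?_⟩)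
      ?_ (Or.inl rfl) ?_ (Or.inr ?_) ?_ (Or.inl rfl) (Or.inr ⟨?_, ?_⟩) ?_ ?_
    · rw [zero_mul]; exact zero_le_one
    · rw [← hy, ← hT]; exact vaH
    · rw [← hT]; exact hcompa
    · rw [zero_mul]; exact zero_le_one
    · rw [← hT]; exact hcompa
    · rw [← hy, ← hT]; exact vaH
    · rw [zero_mul]; exact zero_le_one
    · rw [← hy, ← hT]; exact vbH
    · rw [← hT]; exact hcompb
    · rw [zero_mul]; exact zero_le_one
    · rw [← hT]; exact hcompb
    · rw [← hy, ← hT]; exact vbH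
    · rw [hγ', ← ht1, ← ht2, ← et0]
      have e : σ * ((1 - γ) * t2 * 0 + γ * (1 - t1 - t2) * ϖa + γ * t1 * (1 - 1) * 0 + γ * (t2 + 1 * t1) * ϖa) = σ * (γ * ϖa) := by ring
      rw [e, hσγ]
    · rw [hγ', ← ht1, ← ht2]
      have e : (1 - σ) * ((1 - γ) * t2 * 0 + γ * (1 - q) * ϖb + γ * t1 * (1 - 1) * 0 + γ * (t2 + 1 * t1) * ϖb)
          = (1 - σ) * (γ * ϖb) * ((1 - q) + t1 + t2) := by ring
      rw [e, ← et0, show 1 - t1 - t2 + t1 + t2 = (1:ℝ) by ring, mul_one]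
      exact cov1'

end LawDec
end Quant
end Summit.CriticalPhenomena.PercolationContinuityZ3.Theorems
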